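import Summits.QuantumFields.BalabanUV.T4Continuum.Support.SubstrateRawSpecies
import Summits.QuantumFields.BalabanUV.T4Continuum.Support.SubstrateContourPaths

/-!
# SUBSTRATE — GAUGE COVARIANCE OF THE RAW COVARIANCE SPECIES: along a path contour system (in particular the contour system OF RECORD)
# and for unitary-valued `ι`, `Δ_{U^u} + aQ(U^u)ᴴQ(U^u) = 𝒰·(Δ_U + aQ(U)ᴴQ(U))·𝒰⁻¹`, `G(U^u) = 𝒰·G(U)·𝒰⁻¹` and the UNIT-LATTICE COVARIANCE
# conjugates by the COARSE multipliers, `C(U^u) = 𝒰_c·C(U)·𝒰_c⁻¹` — so every gauge-invariant functional of the covariance species of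
# record is a function of the gauge orbit (follower of `SubstrateRawSpecies` p219509 + `SubstrateContourPaths` p219416)

Cell `pub-balaban`, SUBSTRATE cell, seat `b2b-balaban-substrate-p1`.  Summits-side under the LEAN PLACEMENT RULE (cell library).  HONEST FRAMING:
rung (B)+1 of the FINITE-VOLUME T⁴ programme — NOT infinite volume, NOT a mass gap, NOT Clay; spine PROVED 0∕9.  Pure algebra of the dictionary
([Balaban1987RG1] (0.24) p. 257 asks the terms to be «gauge invariant functions of U» — SHAPE; nothing of Bałaban's terms is asserted).
HONEST DEPENDENCY (cell line, verbatim): continuum YM on T⁴ ⇐ BetaPertH ∧ nine spine estimates (0/9 proved); BetaPertH ⇐ (D1) ∧ (D4) ∧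
CAP+tail; G-an2-4 gates asym, D1 and NE2/3/4.

WHAT.
* §1 The COARSE multipliers are inverse ∕ adjoint to each other (`coarseMulInv`, `siteMul_coarseMul_mul_inv`, `siteMul_coarseMul_conjTranspose`),
  and the algebra of conjugating an inverse: `inv_conj_of_inverse_pair` (`(V·D·W)⁻¹ = V·D⁻¹·W` when `V·W = 1 = W·V`, by `Matrix.mul_inv_rev` +
  `Matrix.inv_eq_left_inv`).
* §2 `QcovOf_conjTranspose_mul_gaugeAct`: `Q(U^u)ᴴQ(U^u) = 𝒰·Q(U)ᴴQ(U)·𝒰⁻¹` (the coarse unitaries drop out), `deltaQOf_gaugeAct`, `greenOf_gaugeAct`,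
  **`unitCovOf_gaugeAct`**: `unitCovOf … (U^u) = siteMul (coarseMul ι base u) * unitCovOf … U * siteMul (coarseMulInv ι base u)` for every
  PATH contour system; `unitCovOf_contour_gaugeAct` for the contour system OF RECORD (`isPathSystem_contour`).
Imports `SubstrateRawSpecies`, `SubstrateContourPaths`; nothing existing is modified.
-/

noncomputable section

open scoped BigOperators Matrix Kronecker Matrix.Norms.L2Operator

namespace Summit.QuantumFields.BalabanUV.T4Continuum.SubstrateRawSpeciesGauge

open Literature.MathematicalPhysics.QuantumFieldTheory.Balaban1983to89
open Literature.MathematicalPhysics.QuantumFieldTheory.Balaban1983to89.B5Prop11Plancherel (Tor fine)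
open Literature.MathematicalPhysics.QuantumFieldTheory.Balaban1983to89.B5Block118 (up)
open Literature.MathematicalPhysics.QuantumFieldTheory.Balaban1983to89.B5G183RateUnitTower (lev lev_neZero)
open Summit.QuantumFields.BalabanUV.T4Continuum.BlockMultiplication (siteMul siteMul_mul siteMul_one siteMul_conjTranspose)
open Summit.QuantumFields.BalabanUV.T4Continuum.CovariantBlockAveraging (ContourSystem contour)
open Summit.QuantumFields.BalabanUV.T4Continuum.SubstrateBackgroundTransporters
open Summit.QuantumFields.BalabanUV.T4Continuum.SubstrateGaugeCovariance
open Summit.QuantumFields.BalabanUV.T4Continuum.SubstrateCovariantAveraging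
open Summit.QuantumFields.BalabanUV.T4Continuum.SubstrateCovariantAveragingGauge
open Summit.QuantumFields.BalabanUV.T4Continuum.SubstrateContourPaths (isPathSystem_contour)
open Summit.QuantumFields.BalabanUV.T4Continuum.SubstrateRawSpecies

/-! ## §1 Coarse multipliers; conjugating an inverse -/

section Coarse

variable {P : Params} {j : ℕ} {M : Fin P.d → ℕ} [hM : ∀ μ, NeZero (M μ)] {base : Tor M → Site P j}
variable {G : Type*} [GaugeGroup G] {o : Type*} [Fintype o] [DecidableEq o] (ι : G →* Matrix o o ℂ)

/-- [folklore] The INVERSE coarse multiplier `(y, μ) ↦ ι(u(base y)⁻¹)`. -/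
def coarseMulInv (base : Tor M → Site P j) (u : GaugeTransf P j G) : Tor M × Fin P.d → Matrix o o ℂ := fun b => ι ((u (base b.1))⁻¹)

omit hM in
/-- [folklore] `coarseMulInv` unfolded. -/
@[simp] theorem coarseMulInv_apply (u : GaugeTransf P j G) (b : Tor M × Fin P.d) : coarseMulInv ι base u b = ι ((u (base b.1))⁻¹) := rfl

/-- [folklore] `siteMul (coarseMul u) * siteMul (coarseMulInv u) = 1`. -/
theorem siteMul_coarseMul_mul_inv (u : GaugeTransf P j G) : siteMul (coarseMul ι base u) * siteMul (coarseMulInv ι base u) = 1 := by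
  rw [siteMul_mul]
  conv_lhs => arg 1; ext b; rw [coarseMul_apply, coarseMulInv_apply, ← map_mul, mul_inv_cancel, map_one]
  exact siteMul_one

/-- [folklore] `siteMul (coarseMulInv u) * siteMul (coarseMul u) = 1`. -/
theorem siteMul_coarseMulInv_mul (u : GaugeTransf P j G) : siteMul (coarseMulInv ι base u) * siteMul (coarseMul ι base u) = 1 := by
  rw [siteMul_mul]
  conv_lhs => arg 1; ext b; rw [coarseMul_apply, coarseMulInv_apply, ← map_mul, inv_mul_cancel, map_one]
  exact siteMul_one

variable {ι} in
omit hM in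
/-- [folklore] For unitary-valued `ι` the adjoint of the coarse multiplier is the inverse one. -/
theorem siteMul_coarseMul_conjTranspose (hι : ∀ g, ι g ∈ Matrix.unitaryGroup o ℂ) (u : GaugeTransf P j G) :
    (siteMul (coarseMul ι base u))ᴴ = siteMul (coarseMulInv ι base u) := by
  rw [siteMul_conjTranspose]
  congr 1
  funext b
  rw [coarseMul_apply, coarseMulInv_apply, UnitaryModel.map_inv_eq_conjTranspose ι hι]

variable {ι} in
omit hM in
/-- [folklore] … and symmetrically. -/
theorem siteMul_coarseMulInv_conjTranspose (hι : ∀ g, ι g ∈ Matrix.unitaryGroup o ℂ) (u : GaugeTransf P j G) :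
    (siteMul (coarseMulInv ι base u))ᴴ = siteMul (coarseMul ι base u) := by
  rw [← siteMul_coarseMul_conjTranspose hι, Matrix.conjTranspose_conjTranspose]

end Coarse

/-- [folklore] CONJUGATING AN INVERSE: for square matrices with `V·W = 1 = W·V`, `(V·D·W)⁻¹ = V·D⁻¹·W` (Matrix's total inverse; no
invertibility of `D` needed: `mul_inv_rev` is unconditional). -/
theorem inv_conj_of_inverse_pair {m : Type*} [Fintype m] [DecidableEq m] {V W D : Matrix m m ℂ} (hVW : V * W = 1) (hWV : W * V = 1) :
    (V * D * W)⁻¹ = V * D⁻¹ * W := by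
  rw [Matrix.mul_inv_rev, Matrix.mul_inv_rev, Matrix.inv_eq_left_inv hVW, Matrix.inv_eq_left_inv hWV, Matrix.mul_assoc]

/-! ## §2 The gauge laws of `Δ_U + aQᴴQ`, of `G(U)` and of the unit-lattice covariance -/

section GaugeLaws

variable (P : Params) {G : Type*} [GaugeGroup G] {o : Type*} [Fintype o] [DecidableEq o] {ι : G →* Matrix o o ℂ}
variable {j k : ℕ} (h : j + k = P.K) {Γ : ContourSystem P.d (lev P.L k) (unitMod P)} {base : Tor (unitMod P) → Site P j}

/-- [folklore] `Q(U^u)ᴴ·Q(U^u) = 𝒰·Q(U)ᴴQ(U)·𝒰⁻¹` — the coarse unitaries drop out of the Gram matrix. -/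
theorem QcovOf_conjTranspose_mul_gaugeAct (hΓ : IsPathSystem (siteIdx P h) Γ base) (hι : ∀ g, ι g ∈ Matrix.unitaryGroup o ℂ)
    (u : GaugeTransf P j G) (U : GaugeField P j G) :
    (QcovOf P ι h Γ (GaugeField.gaugeAct u U))ᴴ * QcovOf P ι h Γ (GaugeField.gaugeAct u U) =
      siteMul (gaugeMul (siteIdx P h) ι u) * ((QcovOf P ι h Γ U)ᴴ * QcovOf P ι h Γ U) * siteMul (gaugeMulInv (siteIdx P h) ι u) := by
  rw [QcovOf_gaugeAct P ι h hΓ u U, Matrix.conjTranspose_mul, Matrix.conjTranspose_mul, siteMul_gaugeMulInv_conjTranspose _ hι,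
    siteMul_coarseMul_conjTranspose hι]
  set Vc := siteMul (coarseMul ι base u)
  set Wc := siteMul (coarseMulInv ι base u)
  set V := siteMul (gaugeMul (siteIdx P h) ι u)
  set W := siteMul (gaugeMulInv (siteIdx P h) ι u)
  set Q := QcovOf P ι h Γ U
  have hc : Wc * Vc = 1 := siteMul_coarseMulInv_mul ι u
  simp only [Matrix.mul_assoc]
  rw [← Matrix.mul_assoc Wc Vc (Q * W), hc, Matrix.one_mul]

/-- [folklore] **`Δ_{U^u} + a·Q(U^u)ᴴQ(U^u) = 𝒰·(Δ_U + a·Q(U)ᴴQ(U))·𝒰⁻¹`** (`covLapOf_gaugeAct` + `QcovOf_conjTranspose_mul_gaugeAct`). -/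
theorem deltaQOf_gaugeAct (hΓ : IsPathSystem (siteIdx P h) Γ base) (hι : ∀ g, ι g ∈ Matrix.unitaryGroup o ℂ) (c : ℂ) (a : ℝ)
    (u : GaugeTransf P j G) (U : GaugeField P j G) :
    deltaQOf P ι h c a Γ (GaugeField.gaugeAct u U) =
      siteMul (gaugeMul (siteIdx P h) ι u) * deltaQOf P ι h c a Γ U * siteMul (gaugeMulInv (siteIdx P h) ι u) := by
  rw [deltaQOf, deltaQOf, covLapOf_gaugeAct (shiftCompatible_siteIdx P h) hι, QcovOf_conjTranspose_mul_gaugeAct P h hΓ hι,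
    Matrix.mul_add, Matrix.add_mul, Matrix.mul_smul, Matrix.smul_mul]

/-- [folklore] **`G(U^u) = 𝒰·G(U)·𝒰⁻¹`**. -/
theorem greenOf_gaugeAct (hΓ : IsPathSystem (siteIdx P h) Γ base) (hι : ∀ g, ι g ∈ Matrix.unitaryGroup o ℂ) (c : ℂ) (a : ℝ)
    (u : GaugeTransf P j G) (U : GaugeField P j G) :
    greenOf P ι h c a Γ (GaugeField.gaugeAct u U) =
      siteMul (gaugeMul (siteIdx P h) ι u) * greenOf P ι h c a Γ U * siteMul (gaugeMulInv (siteIdx P h) ι u) := by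
  rw [greenOf, greenOf, deltaQOf_gaugeAct P h hΓ hι,
    inv_conj_of_inverse_pair (siteMul_gaugeMul_mul_inv _ ι u) (siteMul_gaugeMulInv_mul _ ι u)]

/-- [folklore] **THE UNIT-LATTICE COVARIANCE CONJUGATES BY THE COARSE MULTIPLIERS**: `C(U^u) = 𝒰_c·C(U)·𝒰_c⁻¹` along every path contour system,
for unitary-valued `ι` (the fine multipliers cancel: `W·V = 1`, `W·Wᴴ = W·V = 1`). -/
theorem unitCovOf_gaugeAct (hΓ : IsPathSystem (siteIdx P h) Γ base) (hι : ∀ g, ι g ∈ Matrix.unitaryGroup o ℂ) (c : ℂ) (a : ℝ) (s : ℂ)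
    (u : GaugeTransf P j G) (U : GaugeField P j G) :
    unitCovOf P ι h c a s Γ (GaugeField.gaugeAct u U) =
      siteMul (coarseMul ι base u) * unitCovOf P ι h c a s Γ U * siteMul (coarseMulInv ι base u) := by
  rw [unitCovOf, unitCovOf, QcovOf_gaugeAct P ι h hΓ u U, greenOf_gaugeAct P h hΓ hι, Matrix.conjTranspose_mul, Matrix.conjTranspose_mul,
    siteMul_gaugeMulInv_conjTranspose _ hι, siteMul_coarseMul_conjTranspose hι, Matrix.mul_smul, Matrix.smul_mul]
  set Vc := siteMul (coarseMul ι base u)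
  set Wc := siteMul (coarseMulInv ι base u)
  set V := siteMul (gaugeMul (siteIdx P h) ι u)
  set W := siteMul (gaugeMulInv (siteIdx P h) ι u)
  set Q := QcovOf P ι h Γ U
  set Gr := greenOf P ι h c a Γ U
  have hWV : W * V = 1 := siteMul_gaugeMulInv_mul _ ι u
  congr 1
  simp only [Matrix.mul_assoc]
  rw [← Matrix.mul_assoc W V (Gr * (W * (V * (Qᴴ * Wc)))), hWV, Matrix.one_mul, ← Matrix.mul_assoc W V (Qᴴ * Wc), hWV, Matrix.one_mul]

/-- [folklore] **THE SAME FOR THE CONTOUR SYSTEM OF RECORD** (`SubstrateContourPaths.isPathSystem_contour`): Bałaban's unit-lattice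
covariance of a V1 gauge field is gauge-covariant by coarse conjugation. -/
theorem unitCovOf_contour_gaugeAct (hι : ∀ g, ι g ∈ Matrix.unitaryGroup o ℂ) (c : ℂ) (a : ℝ) (s : ℂ) (u : GaugeTransf P j G)
    (U : GaugeField P j G) :
    unitCovOf P ι h c a s (contour (lev P.L k) (unitMod P)) (GaugeField.gaugeAct u U) =
      siteMul (coarseMul ι (fun y => (siteIdx P h).symm (up (lev P.L k) (unitMod P) y)) u) *
        unitCovOf P ι h c a s (contour (lev P.L k) (unitMod P)) U *
        siteMul (coarseMulInv ι (fun y => (siteIdx P h).symm (up (lev P.L k) (unitMod P) y)) u) :=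
  unitCovOf_gaugeAct P h (isPathSystem_contour (shiftCompatible_siteIdx P h)) hι c a s u U

end GaugeLaws

end Summit.QuantumFields.BalabanUV.T4Continuum.SubstrateRawSpeciesGauge

end
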